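import Summits.BirchSwinnertonDyer.BirchSwinnertonDyer.Theorems.GenusKolyvaginAtTwoMinimalTwinBSDTwoHeegnerIndexUpperOddCutSignFree
import HarnessLib

/-!
# Route `GenusKolyvaginAtTwo`, crux U₂ `MinimalTwinBSDTwo` (stmt-BirchSwinnertonDyer-22985), LINE 23 «twin_swap» v2.5 — KOLYVAGIN'S THEOREM B FOR THE
# TWIN, RANK PART (`rank W^{(d_K)}(ℚ) = 0`), and the DIV′ count `#Ш(W_K)[2^∞] ∣ 4^{M₀}` WITHOUT GZK (from `P(1)` of infinite order), modulo Q2 only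

Seat `bsd-line-gk2-p2` g31 (PROVER seat 2/3, cell `bsd-f1-sign2`, LINE 23 holder), `--supports stmt-BirchSwinnertonDyer-22985 --as helper`.
THEOREMS ONLY (no definition, no named fact, no `sorry`).  BSD is NOT proved by any of this; neither is U₂, nor DIV′, nor NDIV′.

Sequel of this seat's sign-free engine (B2Q⁻±, `…TwinShaAnnihilationSignFree`, p809925) and count (`…HeegnerIndexUpperOddCutSignFree`, p810300).
There the rank input `rank W(ℚ) ≥ 1` of the count came from GZK (`rank_eq_analyticRank_of_analyticRank_le_one`, item 19921) and `r_an(W) = 1`.  Here it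
comes from KOLYVAGIN: the engine kills `Sel_(2^{M₀+1})(W^{(d_K)}/ℚ)` by `2^{M₀}`, so the twin has rank `0` (Kummer, gk2-p3 g27
`mordellWeilRank_eq_zero_of_two_pow_smul_selmer_eq_zero`) — Kolyvagin 1989 Thm. B «`A(ℚ)` is finite» for `A = E^D` — and then `rank W(ℚ) = rank W(K) ≥ 1`
as soon as `P(1)` has infinite order (it lies over a Heegner point `y_K ∈ W(K)`; `rank W(K) = rank W(ℚ) + rank W^{(d_K)}(ℚ)`).

* §1 `mordellWeilRank_twist_eq_zero_signFree` — `rank W^{(d_K)}(ℚ) = 0` on the habitat with `w(W) = −1`, either sign of `Δ`, mod Q2;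
* §2 `one_le_mordellWeilRank_of_derivedPoint_signFree` — `rank W(ℚ) ≥ 1` from `P(1)` of infinite order, mod Q2 (no GZ, no GZK, no analytic rank);
* §3 `finite_and_natCard_primaryComponent_sha_baseChange_two_dvd_pow_of_derivedPoint_signFree` — **`#Ш(W_K)[2^∞] ∣ 4^{M₀}` modulo Q2 ONLY** on the
  habitat with `w(W) = −1`, `#Sel₂(W) = 2`, `P(1)` of infinite order with `2^{M₀+1} ∤ P(1)`, an elliptic `Wd ≅ W^{(d_K)}` inside the genus budget — the
  exact conditionality of the route's closed upper halves U_T / U⁺_T (Q2 alone), now for the `ε = −1` member of LINE 23.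

References: [Kolyvagin1989Izv] Thm. A, Thm. B; [GrossLMS1991] §4 (4.1); [SilvermanAEC2009] VIII.2, X.4.2 (a), Exercise 10.16; [McCallumLMS1991] §5 Cor. 5.6;
[Kramer1981] Thm. 1; [MazurRubin2010] Cor. 3.4 (i).
-/

set_option autoImplicit false
set_option linter.dupNamespace false -- `Summit.<P>.<Sub>` repeats `BirchSwinnertonDyer` (D-0017)

noncomputable section

open scoped Classical

namespace Summit.BirchSwinnertonDyer.BirchSwinnertonDyer.Theorems.GenusExact.TwinSwap.TwinAnnihilation

open Literature.NumberTheory.EllipticCurves Literature.NumberTheory.GaloisRepresentations WeierstrassCurve NumberField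
  IsDedekindDomain Field AddSubgroup Literature.NumberTheory.EllipticCurves.ModularForms
open Summit.BirchSwinnertonDyer.Rank1Residual
open Summit.BirchSwinnertonDyer.BirchSwinnertonDyer.Theses.GenusKolyvaginAtTwo (KolyvaginRelationAtTwo)
open Summit.BirchSwinnertonDyer.BirchSwinnertonDyer.Theorems.GenusExact.PlusDescent

/-! ## §1 Kolyvagin's Theorem B for the twin, rank part -/

/-- **`rank W^{(d_K)}(ℚ) = 0` on the habitat with `w(W) = −1`, either sign of `Δ`, modulo Q2** — the RANK part of Kolyvagin 1989 Thm. B («`A(ℚ)` is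
finite», case `A = E^D`) in the kernel: (B2Q⁻±) `two_pow_smul_selmer_twist_rat_eq_zero_signFree` at level `2^{M₀+1}` and Kummer (gk2-p3 g27
`mordellWeilRank_eq_zero_of_two_pow_smul_selmer_eq_zero`).  No Gross–Zagier, no GZK, no analytic rank. [cite: Kolyvagin1989Izv, Thm. B]
[cite: SilvermanAEC2009, VIII.2, X.4.2 (a)] -/
theorem mordellWeilRank_twist_eq_zero_signFree (hQ2 : KolyvaginRelationAtTwo)
    (W : WeierstrassCurve ℚ) [W.IsElliptic] [W.IsGloballyMinimal] [NeZero (W.conductorNorm ℤ)] (hcm : ¬ W.HasCM)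
    (hT : Odd W.tamagawaProduct) (v : HeightOneSpectrum (𝓞 ℚ)) (h2v : ((2 : ℕ) : 𝓞 ℚ) ∉ v.asIdeal)
    (hNv : ((W.conductorNorm ℤ : ℕ) : 𝓞 ℚ) ∈ v.asIdeal) (hmult : W.HasMultiplicativeReductionAt v)
    (K : Type) [Field K] [NumberField K] (hIQ : IsImaginaryQuadratic K) (hodd : Odd (NumberField.discr K))
    (h3 : NumberField.discr K ≠ -3) (hHe : SatisfiesHeegnerHypothesis (W.conductorNorm ℤ) K)
    (hsq1 : ¬ IsSquare ((NumberField.discr K : ℚ) * -|W.Δ|)) (hsq2 : ¬ IsSquare ((NumberField.discr K : ℚ) * (-(2 * |W.Δ|))))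
    (hρ : ∀ n : ℕ, 0 < n → W.HasSurjectiveModNGaloisRep ((2 : ℤ) ^ n))
    (Dt : ModularParametrizationData W (W.conductorNorm ℤ)) (β : ℤ) (ι : K →+* ℂ) (d₁ : KolyvaginHeegnerData Dt β ι 1) (M₀ : ℕ)
    (hndiv : ¬ ∃ Q : (W.baseChange (ringClassField K ι 1)).toAffine.Point, ((2 ^ (M₀ + 1) : ℕ) : ℤ) • Q = d₁.derivedPoint)
    (hw : W.rootNumber = -1) [(W.quadraticTwist ((NumberField.discr K : ℤ) : ℚ)).IsElliptic] :
    (W.quadraticTwist ((NumberField.discr K : ℤ) : ℚ)).mordellWeilRank = 0 :=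
  mordellWeilRank_eq_zero_of_two_pow_smul_selmer_eq_zero (W.quadraticTwist ((NumberField.discr K : ℤ) : ℚ)) fun s hs ↦
    two_pow_smul_selmer_twist_rat_eq_zero_signFree hQ2 W hcm hT v h2v hNv hmult K hIQ hodd h3 hHe hsq1 hsq2 hρ Dt β ι d₁ M₀ hndiv hw
      (M₀ + 1) s hs

/-! ## §2 `rank W(ℚ) ≥ 1` from `P(1)` of infinite order, without GZK -/

/-- **`rank W(ℚ) ≥ 1` WITHOUT GZK** on the same frame when `P(1)` has infinite order: `P(1)` lies over a Heegner point `y_K ∈ W(K)` (Galois descent, tree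
`AdditiveKoly.exists_isHeegnerPoint_map_eq_derivedPoint_one`), so `rank W(K) ≥ 1`; `rank W(K) = rank W(ℚ) + rank W^{(d_K)}(ℚ)` (Silverman X.10.16) and the
twin has rank `0` (§1).  Modulo Q2 only. [cite: Kolyvagin1989Izv, Thm. A, Thm. B] [cite: GrossLMS1991, §4 (4.1)] [cite: SilvermanAEC2009, Exercise 10.16] -/
theorem one_le_mordellWeilRank_of_derivedPoint_signFree (hQ2 : KolyvaginRelationAtTwo)
    (W : WeierstrassCurve ℚ) [W.IsElliptic] [W.IsGloballyMinimal] [NeZero (W.conductorNorm ℤ)] (hcm : ¬ W.HasCM)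
    (hT : Odd W.tamagawaProduct) (v : HeightOneSpectrum (𝓞 ℚ)) (h2v : ((2 : ℕ) : 𝓞 ℚ) ∉ v.asIdeal)
    (hNv : ((W.conductorNorm ℤ : ℕ) : 𝓞 ℚ) ∈ v.asIdeal) (hmult : W.HasMultiplicativeReductionAt v)
    (K : Type) [Field K] [NumberField K] (hIQ : IsImaginaryQuadratic K) (hodd : Odd (NumberField.discr K))
    (h3 : NumberField.discr K ≠ -3) (hHe : SatisfiesHeegnerHypothesis (W.conductorNorm ℤ) K)
    (hsq1 : ¬ IsSquare ((NumberField.discr K : ℚ) * -|W.Δ|)) (hsq2 : ¬ IsSquare ((NumberField.discr K : ℚ) * (-(2 * |W.Δ|))))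
    (hρ : ∀ n : ℕ, 0 < n → W.HasSurjectiveModNGaloisRep ((2 : ℤ) ^ n))
    (Dt : ModularParametrizationData W (W.conductorNorm ℤ)) (β : ℤ) (ι : K →+* ℂ) (d₁ : KolyvaginHeegnerData Dt β ι 1)
    (hy : ¬ IsOfFinAddOrder d₁.derivedPoint) (M₀ : ℕ)
    (hndiv : ¬ ∃ Q : (W.baseChange (ringClassField K ι 1)).toAffine.Point, ((2 ^ (M₀ + 1) : ℕ) : ℤ) • Q = d₁.derivedPoint)
    (hw : W.rootNumber = -1) : 1 ≤ W.mordellWeilRank := by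
  have hdK0 : ((NumberField.discr K : ℤ) : ℚ) ≠ 0 := by exact_mod_cast NumberField.discr_ne_zero K
  haveI hTell : (W.quadraticTwist ((NumberField.discr K : ℤ) : ℚ)).IsElliptic := W.isElliptic_quadraticTwist hdK0
  haveI hEK : (W.baseChange K).IsElliptic := inferInstanceAs ((W.map (algebraMap ℚ K)).IsElliptic)
  haveI : Module.Finite ℤ (W.baseChange K).toAffine.Point := (W.baseChange K).module_finite_point_holds
  -- the Heegner point `y_K ∈ W(K)` below `P(1)`, of infinite order
  obtain ⟨Ph, -, hPhmap⟩ := AdditiveKoly.exists_isHeegnerPoint_map_eq_derivedPoint_one (W := W) (K := K) (Dt := Dt) (β := β)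
    (ι := ι) hIQ hHe d₁
  have hPinf : ¬ IsOfFinAddOrder Ph := by
    intro hfin
    apply hy
    rw [← hPhmap]
    exact (WeierstrassCurve.Affine.Point.map (W' := W) (algebraMap K (ringClassField K ι 1)).toRatAlgHom).isOfFinAddOrder hfin
  have hK1 : 1 ≤ (W.baseChange K).mordellWeilRank :=
    Literature.NumberTheory.EllipticCurves.one_le_mordellWeilRank_of_not_isOfFinAddOrder (W.baseChange K) inferInstance hPinf
  have hsum := W.mordellWeilRank_baseChange_of_finrank_eq_two_of_finite K hIQ.1
  have hT0 := mordellWeilRank_twist_eq_zero_signFree hQ2 W hcm hT v h2v hNv hmult K hIQ hodd h3 hHe hsq1 hsq2 hρ Dt β ι d₁ M₀ hndiv hw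
  rw [hT0, add_zero] at hsum
  rw [← hsum]
  exact hK1

/-! ## §3 The count `#Ш(W_K)[2^∞] ∣ 4^{M₀}` modulo Q2 only -/

/-- **THE COUNT WITHOUT GZK: `#Ш(W_K)[2^∞] ∣ 4^{M₀}` modulo Q2 ONLY**, on the habitat with `w(W) = −1`, `#Sel₂(W) = 2`, a conductor-`1` datum with `P(1)`
of INFINITE ORDER and `2^{M₀+1} ∤ P(1)`, an elliptic model `Wd ≅ W^{(d_K)}` inside the genus budget `(Δ < 0 ∧ ord₂ C(Wd) ≤ 1) ∨ ord₂ C(Wd) = 0` —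
p810300's `…_of_swappedPair_signFree` fed by §2 (the rank input is Kolyvagin's, not GZK's; the two Theorem-B field exclusions are automatic, gk2-p2 g7).
This is the exact conditionality of the route's upper halves U_T / U⁺_T (Q2 alone), now for the `ε = −1` member of LINE 23.  Closes nothing; BSD is NOT
proved. [cite: Kolyvagin1989Izv, Thm. A, Thm. B_l] [cite: McCallumLMS1991, §5 Cor. 5.6] [cite: Kramer1981, Thm. 1] [cite: MazurRubin2010, Cor. 3.4 (i)] -/
theorem finite_and_natCard_primaryComponent_sha_baseChange_two_dvd_pow_of_derivedPoint_signFree (hQ2 : KolyvaginRelationAtTwo)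
    (W : WeierstrassCurve ℚ) [W.IsElliptic] [W.IsGloballyMinimal] [NeZero (W.conductorNorm ℤ)] (hcm : ¬ W.HasCM)
    (hT : Odd W.tamagawaProduct) (v : HeightOneSpectrum (𝓞 ℚ)) (h2v : ((2 : ℕ) : 𝓞 ℚ) ∉ v.asIdeal)
    (hNv : ((W.conductorNorm ℤ : ℕ) : 𝓞 ℚ) ∈ v.asIdeal) (hmult : W.HasMultiplicativeReductionAt v)
    (K : Type) [Field K] [NumberField K] (hIQ : IsImaginaryQuadratic K) (hodd : Odd (NumberField.discr K))
    (h3 : NumberField.discr K ≠ -3) (hHe : SatisfiesHeegnerHypothesis (W.conductorNorm ℤ) K)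
    (hρ : ∀ n : ℕ, 0 < n → W.HasSurjectiveModNGaloisRep ((2 : ℤ) ^ n))
    (Dt : ModularParametrizationData W (W.conductorNorm ℤ)) (β : ℤ) (ι : K →+* ℂ) (d₁ : KolyvaginHeegnerData Dt β ι 1)
    (hy : ¬ IsOfFinAddOrder d₁.derivedPoint) (M₀ : ℕ)
    (hndiv : ¬ ∃ Q : (W.baseChange (ringClassField K ι 1)).toAffine.Point, ((2 ^ (M₀ + 1) : ℕ) : ℤ) • Q = d₁.derivedPoint)
    (hw : W.rootNumber = -1) (hSel : Nat.card (W.selmerGroup 2) = 2)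
    {Wd : WeierstrassCurve ℚ} [Wd.IsElliptic] (Cd : VariableChange ℚ) (hWd : Cd • W.quadraticTwist (NumberField.discr K : ℚ) = Wd)
    (hbudget : (W.Δ < 0 ∧ padicValNat 2 Wd.tamagawaProduct ≤ 1) ∨ padicValNat 2 Wd.tamagawaProduct = 0) :
    Finite (AddCommGroup.primaryComponent (↥(W.baseChange K).sha) 2) ∧
      Nat.card (AddCommGroup.primaryComponent (↥(W.baseChange K).sha) 2) ∣ 2 ^ (2 * M₀) := by
  obtain ⟨hsq1, hsq2⟩ := kolyvaginExclusions_of_odd_of_satisfiesHeegnerHypothesis W hIQ hodd hHe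
  exact finite_and_natCard_primaryComponent_sha_baseChange_two_dvd_pow_of_swappedPair_signFree hQ2 W hcm hT v h2v hNv hmult K hIQ hodd h3 hHe
    hsq1 hsq2 hρ Dt β ι d₁ M₀ hndiv hw
    (one_le_mordellWeilRank_of_derivedPoint_signFree hQ2 W hcm hT v h2v hNv hmult K hIQ hodd h3 hHe hsq1 hsq2 hρ Dt β ι d₁ hy M₀ hndiv hw)
    hSel Cd hWd hbudget

end Summit.BirchSwinnertonDyer.BirchSwinnertonDyer.Theorems.GenusExact.TwinSwap.TwinAnnihilation

end
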